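import Mathlib
import HarnessLib
import Summits.Ventures.LatticeQCDFlow.Scoring.SU3ConjugacyByTrace

/-!
# The involutions of `SU(3)`: `U² = 1 ⇔ tr U ∈ {3, −1}` — the identity and the single class of `diag(1, −1, −1)`, the endpoint `t = −1` of the real spoke

HONEST FRAMING: exact (Metropolis-corrected) sampling algorithms for lattice gauge theory;
figures of merit are autocorrelation/cost numbers at stated couplings and volumes; no
continuum-physics claim.

Venture `LatticeQCDFlow` (cell pub-lqcd), sub-topic `Scoring`; FANOUT row 21 (`su3-base`: the 4D
`SU(3)` baselines).  NEW WORK of the cell (placement rule), elementary, over row 21 GEN-8's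
`Scoring/SU3ConjugacyByTrace` (`su3_isConj_iff_trace_eq`: the trace decides conjugacy) and the
Literature's `QuantumLattice/GaugeGroupsProofs` (`exists_conj_eq_diagonal`, `eq_one_of_reTr_eq`).
No definition is introduced; nothing is cited as a fact; no number of ours.  Companion of
`SU3TraceDeltoid` (a real trace is `≥ −1`) and `SU3TracelessOrderThree` (order three ⇔ `t = 0` or
centre): here ORDER TWO.

If `U² = 1` the eigenvalues are `±1` with product `1`, so the spectrum is `{1,1,1}` or `{1,−1,−1}`
and `tr U ∈ {3, −1}`.  Conversely `tr U = 3` forces `U = 1`, and `tr U = −1` forces `U` to be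
conjugate to the involution `diag(1, −1, −1)` (the trace decides the class), hence `U² = 1`.  So the
lower endpoint `t = −1` of the real spoke `[−1, 3]` is attained EXACTLY by the non-trivial
involutions of `SU(3)` ("`π`-rotations in a complex 2-plane"), a single conjugacy class.

## What is proved

* `involutionDiag_mem`, `trace_involutionDiag`, `involutionDiag_sq` — `diag(1, −1, −1) ∈ SU(3)`,
  trace `−1`, square `1`;
* **`su3_trace_of_sq_eq_one`** — `U² = 1 ⟹ tr U = 3 ∨ tr U = −1`;
* **`su3_sq_eq_one_of_trace_eq_neg_one`** — `tr U = −1 ⟹ U² = 1`;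
* **`su3_sq_eq_one_iff`** — `U² = 1 ⇔ tr U = 3 ∨ tr U = −1`; `su3_sq_eq_one_iff_of_ne_one`
  (`U ≠ 1`: `U² = 1 ⇔ tr U = −1`).

NOT CLAIMED: anything about `Z₂`-valued observables or centre physics; anything for `N ≠ 3`.
-/

namespace Summit.Ventures.LatticeQCDFlow.Scoring

open Matrix Complex
open Literature.MathematicalPhysics.QuantumLattice

section SpecialUnitaryThree

/-- The model involution `diag(1, −1, −1)` lies in `SU(3)`. -/
theorem involutionDiag_mem :
    Matrix.diagonal (![1, -1, -1] : Fin 3 → ℂ) ∈ Matrix.specialUnitaryGroup (Fin 3) ℂ := by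
  rw [diagonal_mem_specialUnitaryGroup_iff]
  refine ⟨fun i => ?_, ?_⟩
  · fin_cases i <;> simp
  · rw [Fin.prod_univ_three]; simp

/-- Its trace is `−1`. -/
theorem trace_involutionDiag :
    (Matrix.diagonal (![1, -1, -1] : Fin 3 → ℂ)).trace = -1 := by
  rw [trace_diagonal, Fin.sum_univ_three]
  simp

/-- It squares to the identity. -/
theorem involutionDiag_sq :
    (⟨Matrix.diagonal (![1, -1, -1] : Fin 3 → ℂ), involutionDiag_mem⟩ :
      Matrix.specialUnitaryGroup (Fin 3) ℂ) ^ 2 = 1 := by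
  apply Subtype.ext
  change (Matrix.diagonal (![1, -1, -1] : Fin 3 → ℂ)) ^ 2 = 1
  rw [diagonal_pow]
  have h : (![1, -1, -1] : Fin 3 → ℂ) ^ 2 = fun _ => 1 := by
    funext i; fin_cases i <;> simp
  rw [h, diagonal_one]

/-- **`U² = 1 ⟹ tr U ∈ {3, −1}`** on `SU(3)` (eigenvalues `±1` with product `1`). -/
theorem su3_trace_of_sq_eq_one (U : Matrix.specialUnitaryGroup (Fin 3) ℂ) (h : U ^ 2 = 1) :
    (U : Matrix (Fin 3) (Fin 3) ℂ).trace = 3 ∨ (U : Matrix (Fin 3) (Fin 3) ℂ).trace = -1 := by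
  obtain ⟨u, D, d, hD, hU⟩ := exists_conj_eq_diagonal U
  have hp := prod_eq_one_of_coe_eq_diagonal hD
  rw [Fin.prod_univ_three] at hp
  have htr : (U : Matrix (Fin 3) (Fin 3) ℂ).trace = d 0 + d 1 + d 2 := by
    rw [hU]
    change ((u : Matrix (Fin 3) (Fin 3) ℂ) * (D : Matrix (Fin 3) (Fin 3) ℂ) *
        star (u : Matrix (Fin 3) (Fin 3) ℂ)).trace = _
    rw [Matrix.trace_mul_cycle, Unitary.star_mul_self_of_mem u.2.1, Matrix.one_mul, hD,
      trace_diagonal, Fin.sum_univ_three]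
  -- `D² = u⁻¹ U² u = 1`, so each `dᵢ² = 1`
  have hD2 : D ^ 2 = 1 := by
    have hDU : D = u⁻¹ * U * u⁻¹⁻¹ := by rw [inv_inv, hU]; group
    rw [hDU, conj_pow, h, mul_one, inv_inv, inv_mul_cancel]
  have hM : (diagonal d) ^ 2 = (1 : Matrix (Fin 3) (Fin 3) ℂ) := by
    rw [← hD, ← SubmonoidClass.coe_pow, hD2]; rfl
  have hd2 : ∀ i, d i ^ 2 = 1 := by
    intro i
    have h := congrFun (congrFun hM i) i
    rw [diagonal_pow, diagonal_apply_eq, Pi.pow_apply, Matrix.one_apply_eq] at h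
    exact h
  have hpm : ∀ i, d i = 1 ∨ d i = -1 := fun i =>
    mul_self_eq_one_iff.mp (by rw [← pow_two]; exact hd2 i)
  rw [htr]
  rcases hpm 0 with h0 | h0 <;> rcases hpm 1 with h1 | h1 <;> rcases hpm 2 with h2 | h2 <;>
    rw [h0, h1, h2] at hp ⊢ <;> norm_num at hp <;> norm_num

/-- **`tr U = −1 ⟹ U² = 1`**: an `SU(3)` matrix with trace `−1` is conjugate to `diag(1, −1, −1)`
(the trace decides the class), hence an involution. -/
theorem su3_sq_eq_one_of_trace_eq_neg_one (U : Matrix.specialUnitaryGroup (Fin 3) ℂ)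
    (h : (U : Matrix (Fin 3) (Fin 3) ℂ).trace = -1) : U ^ 2 = 1 := by
  have hconj : IsConj U ⟨Matrix.diagonal (![1, -1, -1] : Fin 3 → ℂ), involutionDiag_mem⟩ := by
    rw [su3_isConj_iff_trace_eq, h]
    exact trace_involutionDiag.symm
  obtain ⟨c, hc⟩ := isConj_iff.mp hconj.symm
  -- `U = c J c⁻¹` with `J² = 1`
  rw [← hc, conj_pow, involutionDiag_sq, mul_one, mul_inv_cancel]

/-- **`U² = 1 ⇔ tr U ∈ {3, −1}`** on `SU(3)`. -/
theorem su3_sq_eq_one_iff (U : Matrix.specialUnitaryGroup (Fin 3) ℂ) :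
    U ^ 2 = 1 ↔ (U : Matrix (Fin 3) (Fin 3) ℂ).trace = 3 ∨ (U : Matrix (Fin 3) (Fin 3) ℂ).trace = -1 := by
  constructor
  · exact su3_trace_of_sq_eq_one U
  · rintro (h3 | h1)
    · have hre : reTr U = Fintype.card (Fin 3) := by
        change ((U : Matrix (Fin 3) (Fin 3) ℂ).trace).re = _
        rw [h3, Fintype.card_fin]; norm_num
      rw [eq_one_of_reTr_eq U hre, one_pow]
    · exact su3_sq_eq_one_of_trace_eq_neg_one U h1

/-- Away from the identity: `U² = 1 ⇔ tr U = −1` — the non-trivial involutions are exactly the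
trace-`(−1)` class, the lower endpoint of the real spoke `[−1, 3]`. -/
theorem su3_sq_eq_one_iff_of_ne_one (U : Matrix.specialUnitaryGroup (Fin 3) ℂ) (hU : U ≠ 1) :
    U ^ 2 = 1 ↔ (U : Matrix (Fin 3) (Fin 3) ℂ).trace = -1 := by
  rw [su3_sq_eq_one_iff]
  constructor
  · rintro (h3 | h1)
    · exfalso
      have hre : reTr U = Fintype.card (Fin 3) := by
        change ((U : Matrix (Fin 3) (Fin 3) ℂ).trace).re = _
        rw [h3, Fintype.card_fin]; norm_num
      exact hU (eq_one_of_reTr_eq U hre)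
    · exact h1
  · exact Or.inr

end SpecialUnitaryThree

end Summit.Ventures.LatticeQCDFlow.Scoring
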